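import Summits.BirchSwinnertonDyer.BirchSwinnertonDyer.Theorems.KimAtThreeOffStratumAdditiveDefectOfFineKato
import Summits.BirchSwinnertonDyer.BirchSwinnertonDyer.Theorems.KimAtThreeDeepLowerOffStratumCornerKeysSharp
import Summits.BirchSwinnertonDyer.BirchSwinnertonDyer.Theorems.KimAtThreeDeepLowerSplitGlue
import HarnessLib

/-!
# Route `KimAtThreeKolyvagin` (rung W2), crux `DeepLowerAtThreeOffKatoStratum` (item 19679) and its parent
# `DeepLowerAtThree` (item 19075) BY NAME after PROGRAMME PART 1b: the skeleton's composition run on the two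
# hands' FINAL stub-shaped theorems — non-additive rows keyed to rung K3 / corner X11a@3 / (TD) (seat acc2 gen 3),
# additive-defect rows keyed to the fine Kato package (C1₂) alone + (R₁) (this seat) — cell `bsd-addord`, seat
# `bsd-addord-w2-acc3` (PROGRAMME PART 1b row (3)), gen 3

HONEST FRAMING. Theorems only (no definition, no named fact, no `sorry`); every theorem here is CONDITIONAL — it
concludes the route decl BY NAME but UNDER HYPOTHESES and does NOT close item 19679 or 19075 (landed `--supports
19679 --as helper`); the OWNER of 19679 (seat w2-c2, closed gen 5 with DONE blocked-on 19560) assembles; this file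
only composes, for the planner's residual of record, what the two PART-1b hands landed tonight.  BSD is not proved
by any of this; nothing is booked; no mark moves.

* §A `deepLowerAtThreeOffKatoStratum_of_stubs` — the BC3 birth skeleton's composition
  (`planner/splitW2L/bc/DeepLowerAtThreeOffKatoStratum_birth.lean` e575d03075635394, `DeepLowerAtThreeOffKatoStratum_of`)
  AS A TREE THEOREM: the two registered stub SIGNATURES (`stub_nonAdditive`, `stub_additiveDefect`) as hypotheses,
  the crux BY NAME as conclusion (case split on `Addv W₀ 3`; the skeleton's proof verbatim).
* §B **`deepLowerAtThreeOffKatoStratum_of_cornerKeys_of_fineKato_of_torsionRows`** — crux 19679 BY NAME from: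
  seat acc2 gen 3's ★★★★♯′ `KimAtThreeDeepLowerOffStratumCornerKeysSharp.stub_nonAdditive_of_rungK3_of_x11aThree_sharp_of_tamagawa_le_deepInfty`
  (ELEVEN named published facts `hYZ hW20 hW hSk hmod hGZK hM hBCDT hLL hMi` (+ `hS24 hS24₂ hPT` shared), the
  rung-K3 leaf `Supersingular.SignedSupersingular`, corner X11a's `X11a.TargetThree`, and (TD) Tamagawa
  divisibility of the deep Kurihara numbers on the non-additive rows with `3 ∣ ∏ c_ℓ`) as `h₁`, and this seat's
  `KimAtThreeOffStratumAdditiveDefectOfFineKato.stub19679_additiveDefect_of_fineKato_of_torsionRows` ([S24] (1)(2),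
  GZK, Poitou–Tate + the fine Kato package (C1₂) + the `t ≥ 1` line (R₁)) as `h₂`.
* §C `deepLowerAtThree_of_katoStratumSharedParts_of_cornerKeys_of_fineKato_of_torsionRows` — the PARENT crux 19075
  BY NAME: seat w2-c2's §L glue `KimAtThreeDeepLowerSplitGlue.deepLowerAtThree_of_parts` on the alias
  `KatoStratumSharedParts` (item 19678: Sakamoto ×2 ∧ GZK ∧ PT ∧ Carayol ∧ PORT″ crux 19560) and §B.

RESIDUAL OF 19679 / 19075 IN THE TREE AFTER PART 1b (the hypotheses of §B / §C, nothing else): named print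
(Yan–Zhu 2026 Thm 4.15, Wuthrich 2014 L20 + Prop 21, Skinner 2016 Thm C, modularity ×2, GZK, Mazur 1978, Diamond
1995, Miller 2011 Thm 1.2, Sakamoto 2024 Thm 4.4 (1)(2), Poitou–Tate); rung K3's leaf `SignedSupersingular`; corner
X11a's `TargetThree`; (TD) on the non-additive `3 ∣ ∏ c_ℓ` rows; the fine Kato package (C1₂) on the `t = 0`
additive-defect rows (CONSTRUCTION-SHAPED: object = the dual exponential, `defn-BlochKatoDualExponential`; = crux
19560's (C1) with rider (ii) ↦ (ii₂)); the one displayed line (R₁) on the `t ≥ 1` additive rows; and, for 19075,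
the alias 19678 (⊇ crux 19560).  No S24-DEEP, no PORT₂ line, no (C2₂)/(C3₂), no anonymous lower-half family.
References: [Kim2025RefinedTNC] Thm 1.1, §8.1.2; [Kim2022StructureSelmer] Thm. 1.9 (6), Thm. 3.13, Conj. 1.10;
[Sakamoto2024] Thm. 4.4; [MazurRubin2004] Thm. 5.2.12; [Kato2004Asterisque] §9.4, Thm. 9.7, Ex. 13.3;
[YanZhu2024MainConjNonCM] Thm. 4.15; [Wuthrich2014] Lemma 20, Prop. 21; [Skinner2016PacificMC] Thm. C;
[Miller2011LMS] Thm. 1.2; [Mazur1978] Cor. 4.1; [Diamond1995RefinedSerre] Thm. 1.1; [Carayol1986].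
-/

set_option autoImplicit false
-- the Theorems namespace of a single-conjunct summit repeats the summit name by design (D-0017)
set_option linter.dupNamespace false

noncomputable section

open scoped NumberField TensorProduct ContRepresentation Classical MatrixGroups ModularForm
open Field Finset IsDedekindDomain NumberField WeierstrassCurve Rat.HeightOneSpectrum CongruenceSubgroup
open Literature.NumberTheory.GaloisRepresentations Literature.NumberTheory.GaloisCohomology
open Literature.NumberTheory.GaloisRepresentations.DiscreteGaloisModule
open Literature.NumberTheory.EllipticCurves Literature.NumberTheory.EllipticCurves.ModularForms
open Literature.NumberTheory.EllipticCurves.Rank1Residual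
open Literature.NumberTheory.EllipticCurves.Rank1Residual.Typed
open Literature.NumberTheory.EllipticCurves.Skinner2016
open Literature.NumberTheory.Automorphic
open Literature.NumberTheory.EllipticCurves.Kato2004
open Literature.NumberTheory.EllipticCurves.Kato2004.EulerSystemValues
open Summit.BirchSwinnertonDyer.Rank1Residual
open Summit.BirchSwinnertonDyer.Rank1Residual.GaloisImage
open Summit.BirchSwinnertonDyer.BirchSwinnertonDyer.Theses.KimAtThreeKolyvagin
open Summit.BirchSwinnertonDyer.BirchSwinnertonDyer.Theorems.Rank1ResidualX1Defs
open Summit.BirchSwinnertonDyer.BirchSwinnertonDyer.Theorems.KimAtThreeKolyvaginDefs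
open Summit.BirchSwinnertonDyer.BirchSwinnertonDyer.Theorems.KimAtThreeOffStratumAdditiveDefectOfFineKato
open Summit.BirchSwinnertonDyer.BirchSwinnertonDyer.Theorems.KimAtThreeDeepLowerOffStratumCornerKeysSharp
open Summit.BirchSwinnertonDyer.BirchSwinnertonDyer.Theorems.KimAtThreeDeepLowerSplitGlue

namespace Summit.BirchSwinnertonDyer.BirchSwinnertonDyer.Theorems.KimAtThreeDeepLowerOffKatoStratumAssemblyFineKato

/-- Local notation: the TWO-EXPONENT rider clause (ii₂) at depth `j`, torsion exponent `t`, defect exponent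
`e`, place `v`, for the pair `(Λ, Λf)` (n1011's `KatoExpStarFiniteLevelAt` clause (ii), conclusion `× 3^e`). -/
local notation3 (prettyPrint := false) "RIDER₂⟦" W' ", " j ", " t' ", " e' ", " v' ", " Λ' ", " Λf "⟧" =>
  ∀ (r : Finset (HeightOneSpectrum (𝓞 ℚ)))
    (Ψ : H1 (tateRep W' 3) (cycSubgroup 3 0 r) →+
      continuousCohomology 1
        (subgroupRep (WeierstrassCurve.torsionGaloisModule W' (((3 : ℕ) : ℤ) ^ j * ((3 : ℕ) : ℤ))).toTopRep
          (cycSubgroup 3 0 r))),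
    (∀ (φ : contOneCocycles (subgroupRep (tateRep W' 3).toTopRep (cycSubgroup 3 0 r)))
        (ψ : contOneCocycles
          (subgroupRep (WeierstrassCurve.torsionGaloisModule W' (((3 : ℕ) : ℤ) ^ j * ((3 : ℕ) : ℤ))).toTopRep
            (cycSubgroup 3 0 r))),
        (∀ g, ((ψ.1 g : geomTorsion W' (((3 : ℕ) : ℤ) ^ j * ((3 : ℕ) : ℤ))) : geomPoints W') =
          TateModule.proj 3 (j + 1) (φ.1 g)) →
        Ψ (oneCocycleClass _ φ) = oneCocycleClass _ ψ) →
    ∀ (y : H1 (tateRep W' 3) (cycSubgroup 3 0 r))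
      (κ₀ : galoisCohomology (WeierstrassCurve.torsionGaloisModule W' (((3 : ℕ) : ℤ) ^ j * ((3 : ℕ) : ℤ))) 1)
      (s : ℤ_[3]),
      resSubgroup (WeierstrassCurve.torsionGaloisModule W' (((3 : ℕ) : ℤ) ^ j * ((3 : ℕ) : ℤ))).toTopRep
          (cycSubgroup 3 0 r) 1 κ₀ = Ψ y →
      galoisCohomology.localization (WeierstrassCurve.torsionGaloisModule W' (((3 : ℕ) : ℤ) ^ j * ((3 : ℕ) : ℤ)))
          (Sum.inr v') 1 κ₀ ∈ propagatedSelmerStructure W' 3 j (Sum.inr v') →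
      (∃ l ∈ cycIntLattice 3 (cycLevel 3 0 r),
          (((3 : ℕ) : ℤ_[3]) ^ t') • Λ' 0 r y - ((s : ℚ_[3]) ⊗ₜ[ℚ] (1 : CyclotomicField (cycLevel 3 0 r) ℚ)) =
            (((3 : ℕ) : ℤ_[3]) ^ (j + 1)) • (l : ℚ_[3] ⊗[ℚ] CyclotomicField (cycLevel 3 0 r) ℚ)) →
      ((3 ^ e' : ℕ) : ZMod (3 ^ (j + 1))) *
        Λf (galoisCohomology.localization
          (WeierstrassCurve.torsionGaloisModule W' (((3 : ℕ) : ℤ) ^ j * ((3 : ℕ) : ℤ))) (Sum.inr v') 1 κ₀) =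
        PadicInt.toZModPow (j + 1) s

/-- Local notation: **(C1₂) the FINE KATO PACKAGE in two-exponent form** on the additive-defect rows. -/
local notation3 (prettyPrint := false) "FINEKATO₂" =>
  ∀ (W : WeierstrassCurve ℚ) [W.IsElliptic] [W.IsGloballyMinimal]
    [ContinuousSMul ℤ_[3] (W.tateModule 3)] [Module.Free ℤ_[3] (W.tateModule 3)]
    [Module.Finite ℤ_[3] (W.tateModule 3)],
    (∀ m : ℕ, W.HasSurjectiveModNGaloisRep (3 ^ m : ℕ)) →
    (haveI : Fact (Nat.Prime 3) := ⟨Nat.prime_three⟩; Addv W 3) →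
    Nat.card {Q : (W.baseChange ℚ_[3]).toAffine.Point // (3 : ℕ) • Q = 0} = 1 →
    ∀ (v₃ : HeightOneSpectrum (𝓞 ℚ)), ((3 : ℕ) : 𝓞 ℚ) ∈ v₃.asIdeal →
    ∀ {N : ℕ} [NeZero N] (P : ModularParametrizationData W N), N = W.conductorNorm ℤ →
      (∀ z ∈ P.L.lattice, ∃ w ∈ periodLattice P.f, z = P.c * w) →
      (3 ∣ (W.baseChange ℚ_[3]).localTamagawaNumber ℤ_[3] ∨ (3 : ℤ) ∣ P.maninConstant) →
      ∃ (ι : (n : ℕ) → (CyclotomicField n ℚ →+* ℂ)) (κK : ℝ)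
        (Λ : ∀ (k' : ℕ) (r : Finset (HeightOneSpectrum (𝓞 ℚ))),
          H1 (tateRep W 3) (cycSubgroup 3 k' r) →ₗ[ℤ_[3]]
            ℚ_[3] ⊗[ℚ] CyclotomicField (cycLevel 3 k' r) ℚ)
        (Λfin : ∀ j : ℕ, galoisCohomology
          ((W.torsionGaloisModule (((3 : ℕ) : ℤ) ^ j * ((3 : ℕ) : ℤ))).toLocal (Sum.inr v₃)) 1 →+
            ZMod (3 ^ (j + 1))) (e : ℕ),
        κK ≠ 0 ∧ (∃ u : ℚ, (u : ℝ) = κK ∧ padicValRat 3 u = 0) ∧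
        (∀ j : ℕ,
          (∀ c : ZMod (3 ^ (j + 1)), ∃ x ∈ propagatedSelmerStructure W 3 j (Sum.inr v₃), Λfin j x = c) ∧
          (∀ x ∈ propagatedSelmerStructure W 3 j (Sum.inr v₃),
            Λfin j x = 0 ↔ x ∈ W.kummerSelmerStructure (((3 : ℕ) : ℤ) ^ j * ((3 : ℕ) : ℤ)) (Sum.inr v₃))) ∧
        (∀ j : ℕ, RIDER₂⟦W, j, 0, e, v₃, Λ, Λfin j⟧) ∧
        ∀ (c d a : ℤ) (A : ℕ), 0 < A → Int.gcd c (6 * 3 * A) = 1 → Int.gcd d (6 * 3 * N) = 1 →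
          ∃ (z : ∀ (k' : ℕ) (r : (cyclotomicLevelsRat 3 (badPlaces c d A N)).Ideals),
                H1 (tateRep W 3) ((cyclotomicLevelsRat 3 (badPlaces c d A N)).level k' r.1))
            (x : ∀ (k' : ℕ) (r : (cyclotomicLevelsRat 3 (badPlaces c d A N)).Ideals),
                CyclotomicField (cycLevel 3 k' r.1) ℚ),
            ZetaBody W 3 P.f ι κK Λ c d a A z x

/-- Local notation: **(R₁) the `t ≥ 1` additive rows** — the conclusion of crux 19679 DISPLAYED on the additive
optimal tower rows of analytic rank `0` with `#E(ℚ₃)[3] ≠ 1` (binders of the registered stub verbatim, the defect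
disjunction replaced by its torsion disjunct; this seat's TorsionSplit §8 `hTors`). -/
local notation3 (prettyPrint := false) "TORSROWS" =>
  ∀ (W₀ : WeierstrassCurve ℚ) [W₀.IsElliptic] [W₀.IsGloballyMinimal],
    (∀ n : ℕ, W₀.HasSurjectiveModNGaloisRep (3 ^ n : ℕ)) → Finite W₀.sha →
    ∀ {N : ℕ} [NeZero N], N = W₀.conductorNorm ℤ →
    ∀ (D₀ : ModularParametrizationData W₀ N),
      (∀ z ∈ D₀.L.lattice, ∃ w ∈ periodLattice D₀.f, z = D₀.c * w) →
      (∀ (W₂ : WeierstrassCurve ℚ) [W₂.IsElliptic] (D₂ : ModularParametrizationData W₂ N),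
        D₂.f = D₀.f → D₀.modularDegree ≤ D₂.modularDegree) →
      (∀ r : ℚ, ratPlusSymbol D₀.f r ≠ 0 → 0 ≤ padicValRat 3 (ratPlusSymbol D₀.f r)) →
      kuriharaVanishingOrder W₀ 3 D₀.f = 0 →
      (haveI : Fact (Nat.Prime 3) := ⟨Nat.prime_three⟩; Addv W₀ 3) →
      Nat.card {Q : (W₀.baseChange ℚ_[3]).toAffine.Point // (3 : ℕ) • Q = 0} ≠ 1 →
      ∃ d : ℕ, kuriharaPartialDeepInfty W₀ 3 D₀.f = d ∧
        kuriharaPartial W₀ 3 D₀.f 0 ≤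
          ((padicValNat 3 (Nat.card (AddCommGroup.primaryComponent W₀.sha 3)) + d : ℕ) : ℕ∞)

/-- Local notation: the registered `stub_additiveDefect` signature of crux 19679 (BC3 birth skeleton e575d030),
VERBATIM. -/
local notation3 (prettyPrint := false) "STUB19679" =>
  ∀ (W₀ : WeierstrassCurve ℚ) [W₀.IsElliptic] [W₀.IsGloballyMinimal],
    (∀ n : ℕ, W₀.HasSurjectiveModNGaloisRep (3 ^ n : ℕ)) → Finite W₀.sha →
    ∀ {N : ℕ} [NeZero N], N = W₀.conductorNorm ℤ →
    ∀ (D₀ : Literature.NumberTheory.EllipticCurves.ModularForms.ModularParametrizationData W₀ N),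
      (∀ z ∈ D₀.L.lattice, ∃ w ∈ Literature.NumberTheory.EllipticCurves.ModularForms.periodLattice D₀.f, z = D₀.c * w) →
      (∀ (W₂ : WeierstrassCurve ℚ) [W₂.IsElliptic]
        (D₂ : Literature.NumberTheory.EllipticCurves.ModularForms.ModularParametrizationData W₂ N),
        D₂.f = D₀.f → D₀.modularDegree ≤ D₂.modularDegree) →
      (∀ r : ℚ, Literature.NumberTheory.EllipticCurves.ratPlusSymbol D₀.f r ≠ 0 →
        0 ≤ padicValRat 3 (Literature.NumberTheory.EllipticCurves.ratPlusSymbol D₀.f r)) →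
      Literature.NumberTheory.EllipticCurves.kuriharaVanishingOrder W₀ 3 D₀.f = 0 →
      (haveI : Fact (Nat.Prime 3) := ⟨Nat.prime_three⟩;
          Literature.NumberTheory.EllipticCurves.Rank1Residual.Addv W₀ 3) →
      (3 ∣ (W₀.baseChange ℚ_[3]).localTamagawaNumber ℤ_[3] ∨
        Nat.card {Q : (W₀.baseChange ℚ_[3]).toAffine.Point // (3 : ℕ) • Q = 0} ≠ 1 ∨
        (3 : ℤ) ∣ D₀.maninConstant) →
      ∃ d : ℕ, Literature.NumberTheory.EllipticCurves.kuriharaPartialDeepInfty W₀ 3 D₀.f = d ∧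
        Literature.NumberTheory.EllipticCurves.kuriharaPartial W₀ 3 D₀.f 0 ≤
          ((padicValNat 3 (Nat.card (AddCommGroup.primaryComponent W₀.sha 3)) + d : ℕ) : ℕ∞)

/-- Local notation: the registered `stub_nonAdditive` signature of crux 19679 (BC3 birth skeleton e575d030),
VERBATIM. -/
local notation3 (prettyPrint := false) "STUBNONADD" =>
  ∀ (W₀ : WeierstrassCurve ℚ) [W₀.IsElliptic] [W₀.IsGloballyMinimal],
    (∀ n : ℕ, W₀.HasSurjectiveModNGaloisRep (3 ^ n : ℕ)) → Finite W₀.sha →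
    ∀ {N : ℕ} [NeZero N], N = W₀.conductorNorm ℤ →
    ∀ (D₀ : Literature.NumberTheory.EllipticCurves.ModularForms.ModularParametrizationData W₀ N),
      (∀ z ∈ D₀.L.lattice, ∃ w ∈ Literature.NumberTheory.EllipticCurves.ModularForms.periodLattice D₀.f, z = D₀.c * w) →
      (∀ (W₂ : WeierstrassCurve ℚ) [W₂.IsElliptic]
        (D₂ : Literature.NumberTheory.EllipticCurves.ModularForms.ModularParametrizationData W₂ N),
        D₂.f = D₀.f → D₀.modularDegree ≤ D₂.modularDegree) →
      (∀ r : ℚ, Literature.NumberTheory.EllipticCurves.ratPlusSymbol D₀.f r ≠ 0 →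
        0 ≤ padicValRat 3 (Literature.NumberTheory.EllipticCurves.ratPlusSymbol D₀.f r)) →
      Literature.NumberTheory.EllipticCurves.kuriharaVanishingOrder W₀ 3 D₀.f = 0 →
      ¬ (haveI : Fact (Nat.Prime 3) := ⟨Nat.prime_three⟩;
          Literature.NumberTheory.EllipticCurves.Rank1Residual.Addv W₀ 3) →
      ∃ d : ℕ, Literature.NumberTheory.EllipticCurves.kuriharaPartialDeepInfty W₀ 3 D₀.f = d ∧
        Literature.NumberTheory.EllipticCurves.kuriharaPartial W₀ 3 D₀.f 0 ≤
          ((padicValNat 3 (Nat.card (AddCommGroup.primaryComponent W₀.sha 3)) + d : ℕ) : ℕ∞)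

/-- Local notation: **(TD)** — Tamagawa divisibility of the deep Kurihara numbers on the NON-ADDITIVE tower rows of
analytic rank `0` with `3 ∣ ∏ c_ℓ` (seat acc2's binder `hTD` VERBATIM; Kim's Conj. 1.10 `≥`-half, deep reading —
displayed, never a fact). -/
local notation3 (prettyPrint := false) "TAMDIV" =>
  ∀ (W : WeierstrassCurve ℚ) [W.IsElliptic] [W.IsGloballyMinimal],
    (∀ n : ℕ, W.HasSurjectiveModNGaloisRep (3 ^ n : ℕ)) →
    ∀ {N : ℕ} [NeZero N] (f : CuspForm (Gamma0 N) 2), IsNewformOf W f →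
    kuriharaVanishingOrder W 3 f = 0 →
    ¬ (haveI : Fact (Nat.Prime 3) := ⟨Nat.prime_three⟩; Addv W 3) → 3 ∣ W.tamagawaProduct →
      ((padicValNat 3 W.tamagawaProduct : ℕ) : ℕ∞) ≤ kuriharaPartialDeepInfty W 3 f

/-! ### §A The skeleton's composition as a tree theorem -/

/-- **The BC3 birth skeleton's composition `DeepLowerAtThreeOffKatoStratum_of`, AS A TREE THEOREM**: the two
registered stub signatures of crux 19679 — `stub_nonAdditive` (`h₁`) and `stub_additiveDefect` (`h₂`) — give the crux
BY NAME (case split on `Addv W₀ 3`; on an additive row the off-stratum hypothesis supplies the defect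
disjunction).  Proof = the skeleton's (planner bsd-addord-plan g16), verbatim up to `push_neg ↦ push Not`.
CONDITIONAL (both stubs are hypotheses); does not close the item. [cite: Kim2025RefinedTNC, Thm 1.1 and §8.1.2]
[cite: Kim2022StructureSelmer, Thm. 1.9 (6)] -/
theorem deepLowerAtThreeOffKatoStratum_of_stubs (h₁ : STUBNONADD) (h₂ : STUB19679) :
    DeepLowerAtThreeOffKatoStratum := by
  intro W₀ _ _ htow hfin N _ hN D₀ hopt hdeg hint hord hoff
  by_cases hA : (haveI : Fact (Nat.Prime 3) := ⟨Nat.prime_three⟩;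
      Literature.NumberTheory.EllipticCurves.Rank1Residual.Addv W₀ 3)
  · refine h₂ W₀ htow hfin hN D₀ hopt hdeg hint hord hA ?_
    by_contra hcon
    push Not at hcon
    exact hoff ⟨hA, hcon.1, hcon.2.1, hcon.2.2⟩
  · exact h₁ W₀ htow hfin hN D₀ hopt hdeg hint hord hA

/-! ### §B Crux 19679 BY NAME from the two hands' final stub theorems -/

/-- **Crux `DeepLowerAtThreeOffKatoStratum` (item 19679) BY NAME after PROGRAMME PART 1b** — §A on: (`h₁`) seat
acc2 gen 3's ★★★★♯′ `stub_nonAdditive_of_rungK3_of_x11aThree_sharp_of_tamagawa_le_deepInfty` from ELEVEN named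
published facts (`hYZ` Yan–Zhu 2026 Thm. 4.15, `hW20` Wuthrich 2014 Lemma 20, `hW` Wuthrich Prop. 21, `hSk` Skinner
2016 Thm. C, `hmod` modularity, `hGZK`, `hM` Mazur 1978, `hBCDT` modularity (newform), `hLL` Diamond 1995 / Ribet,
`hMi` Miller 2011 Thm. 1.2), the rung-K3 leaf `hK3 : Supersingular.SignedSupersingular`, corner X11a's
`hT3 : X11a.TargetThree`, and (TD) `hTD`; (`h₂`) this seat's `stub19679_additiveDefect_of_fineKato_of_torsionRows` from
[S24] (1)(2) `hS24 hS24₂`, `hGZK`, Poitou–Tate `hPT`, the fine Kato package (C1₂) `hC1` and the `t ≥ 1` line (R₁)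
`hTors`.  CONDITIONAL: does not close the item; every displayed input stays OPEN; nothing booked.
[cite: Kim2025RefinedTNC, Thm 1.1 and §8.1.2] [cite: Kim2022StructureSelmer, Thm. 1.9 (6), Thm. 3.13, Conj. 1.10 (PDF p. 8)]
[cite: Sakamoto2024, Thm. 4.4 (1)(2) (p. 926)] [cite: MazurRubin2004, Thm. 5.2.12] [cite: YanZhu2024MainConjNonCM, Thm. 4.15 (§4.6)]
[cite: Wuthrich2014, Lemma 20 and Prop. 21] [cite: Skinner2016PacificMC, Thm. C (§1)] [cite: Miller2011LMS, Thm. 1.2, Def. 1.1]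
[cite: Mazur1978, Cor. 4.1] [cite: Ribet1990, Thm. 1.1] [cite: Kato2004Asterisque, §9.4 and Thm. 9.7 (pp. 188–189), Ex. 13.3 (pp. 224–225)] -/
theorem deepLowerAtThreeOffKatoStratum_of_cornerKeys_of_fineKato_of_torsionRows
    (hYZ : YanZhu2026.thm415_padicValRat_bsd_rank_le_one)
    (hW20 : Wuthrich2014.lemma20_surjective_threeAdic_of_semistable)
    (hW : Wuthrich2014.sha_dvd_analyticSha)
    (hSk : Skinner2016.thmC_padicValRat_bsd_rank_zero)
    (hmod : hasEntireLFunction_rat) (hGZK : rank_eq_analyticRank_of_analyticRank_le_one)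
    (hM : mazur_not_dvd_maninConstant_of_odd)
    (hBCDT : exists_isNewformOf) (hLL : diamond1995_refinedSerre)
    (hMi : bsdp_of_irreducible_of_conductor_lt)
    (hS24 : Sakamoto2024.kolyvaginSystems_freeRankOne_zmod_three_pow)
    (hS24₂ : Sakamoto2024.kolyvaginSystems_idealOfBasis_eq_fittingIdeal_zmod_three_pow)
    (hPT : poitouTate_selmerStructure_duality ℚ)
    (hK3 : Supersingular.SignedSupersingular) (hT3 : X11a.TargetThree) (hTD : TAMDIV)
    (hC1 : FINEKATO₂) (hTors : TORSROWS) :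
    DeepLowerAtThreeOffKatoStratum :=
  deepLowerAtThreeOffKatoStratum_of_stubs
    (stub_nonAdditive_of_rungK3_of_x11aThree_sharp_of_tamagawa_le_deepInfty hYZ hW20 hW hSk hmod hGZK hM hBCDT
      hLL hMi hK3 hT3 hTD)
    (stub19679_additiveDefect_of_fineKato_of_torsionRows hS24 hS24₂ hGZK hPT hC1 hTors)

/-! ### §C The parent crux 19075 BY NAME -/

/-- **The PARENT crux `DeepLowerAtThree` (item 19075) BY NAME after PROGRAMME PART 1b**: seat w2-c2's §L glue
`KimAtThreeDeepLowerSplitGlue.deepLowerAtThree_of_parts` on the alias `KatoStratumSharedParts` (item 19678 =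
Sakamoto 2024 Thm. 4.4 ×2 ∧ GZK ∧ Poitou–Tate ∧ Carayol ∧ the PORT″ crux 19560) and §B — [S24] (1)(2), GZK and
Poitou–Tate are taken FROM the alias, so besides 19678 the parent displays exactly §B's inputs minus those three.
CONDITIONAL: does not close 19075; nothing booked. [cite: Kim2025RefinedTNC, Thm 1.1] [cite: Sakamoto2024, Thm. 4.4 (p. 926)]
[cite: MazurRubin2004, Thm. 5.2.12] [cite: Carayol1986] [cite: MilneADT2006, Ch. I, Thm. 4.10] -/
theorem deepLowerAtThree_of_katoStratumSharedParts_of_cornerKeys_of_fineKato_of_torsionRows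
    (hK : KatoStratumSharedParts)
    (hYZ : YanZhu2026.thm415_padicValRat_bsd_rank_le_one)
    (hW20 : Wuthrich2014.lemma20_surjective_threeAdic_of_semistable)
    (hW : Wuthrich2014.sha_dvd_analyticSha)
    (hSk : Skinner2016.thmC_padicValRat_bsd_rank_zero)
    (hmod : hasEntireLFunction_rat)
    (hM : mazur_not_dvd_maninConstant_of_odd)
    (hBCDT : exists_isNewformOf) (hLL : diamond1995_refinedSerre)
    (hMi : bsdp_of_irreducible_of_conductor_lt)
    (hK3 : Supersingular.SignedSupersingular) (hT3 : X11a.TargetThree) (hTD : TAMDIV)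
    (hC1 : FINEKATO₂) (hTors : TORSROWS) :
    DeepLowerAtThree := by
  obtain ⟨hSak, hGZK, hPT, hlev, hPort⟩ := hK
  exact deepLowerAtThree_of_parts hSak hGZK hPT hlev hPort
    (deepLowerAtThreeOffKatoStratum_of_cornerKeys_of_fineKato_of_torsionRows hYZ hW20 hW hSk hmod hGZK hM hBCDT
      hLL hMi hSak.1 hSak.2 hPT hK3 hT3 hTD hC1 hTors)

end Summit.BirchSwinnertonDyer.BirchSwinnertonDyer.Theorems.KimAtThreeDeepLowerOffKatoStratumAssemblyFineKato

end
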